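import Summits.ABC.ABC.Theorems.DefiniteXiFreyModularityStubAbsIrrSqrtFiveGroup
import Summits.ABC.ABC.Theorems.DefiniteXiFreyModularityStubAbsIrrSqrtFiveLocal
import Literature.NumberTheory.Automorphic.CDTTheorem712ConductorStepProofs
import Literature.NumberTheory.EllipticCurves.SerreOpenImageSupersingularAssemblyProofs
import Literature.NumberTheory.EllipticCurves.SerreOpenImageTameKummerProofs
import Literature.NumberTheory.EllipticCurves.GlobalMinimalModelProofs
import Literature.NumberTheory.EllipticCurves.IsogenyVariableChangeProofs
import Literature.NumberTheory.DiophantineGeometry.ConductorAdditiveProofs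
import Literature.NumberTheory.DiophantineGeometry.ConductorFactorizationProofs
import Literature.NumberTheory.DiophantineGeometry.ConductorRingOfIntegersProofs
import HarnessLib

/-!
# Crux `FreyModularity` (stmt-ABC-11340), line `Sketch`: the stub `stub_absIrrSqrtFive`
# (Rubin, CSS 1997, Prop. 7) — proved

The registered stub `stub_absIrrSqrtFive` of the line `Sketch` of the crux
`Summit.ABC.ABC.Theses.DefiniteXi.FreyModularity`: **for an elliptic curve `E/ℚ` with `25 ∤ N_E`
(semistable at `5`) and a framed model `ρ̄` of `E[5]` which is irreducible, `ρ̄|_{ℚ(√5)}` is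
absolutely irreducible** (K. Rubin, *Modularity of mod 5 representations*, Cornell–Silverman–
Stevens 1997, Prop. 7; it replaces Elkies' Lemma 7.2.3 of Conrad–Diamond–Taylor 1999 for Frey
curves).  Proof (purely local at `5`, plus the group theory of `…StubAbsIrrSqrtFiveGroup`):

* `hasGoodReductionAt_or_hasMultiplicativeReductionAt_of_not_dvd_conductorNorm` — `25 ∤ N_E`
  gives `f₅ ≤ 1` (`factorization_conductorNorm_holds`), hence good or multiplicative reduction
  at `5` (`two_le_conductorExponent_iff_holds`);
* `exists_sq_mulVec_eq_self_of_one_lt_valuation_j` — multiplicative: `ord_5(j) < 0`, an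
  inertia element `τ₀` with `χ̄₅(τ₀) = 2` (`exists_mem_inertia_modNCyclotomicCharacter_eq`) has
  `#((τ₀² - 1) E[5]) ≤ 5` (Tate form, `…StubAbsIrrSqrtFiveLocal`), so `ρ̄(τ₀²)` fixes a
  non-zero vector;
* `exists_sq_mulVec_eq_self_of_not_dvd_frobeniusTrace` — good ordinary, on a global minimal
  model: an inertia element acting as `(2 *; 0 1)` (Serre 1972, §1.11, Prop. 11 and Cor.; the
  tree's `exists_line_of_not_dvd_frobeniusTrace_of_mem_primesAbove`,
  `exists_mem_inertia_smul_eq_of_sub_mem_line`);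
* `exists_orderOf_eq_three_of_dvd_frobeniusTrace` — good supersingular: the image of inertia is
  cyclic of order `24` (Serre 1972, Prop. 12 c); the tree's
  `isCyclic_and_card_inertia_map_of_dvd_frobeniusTrace`), whence an element of order `3`;
* `exists_sq_mulVec_eq_self_or_orderOf_eq_three` — the local datum, read on a global minimal
  model `C • E` (`hasGlobalMinimalModel_rat_holds`, `isTorsionGaloisRep_of_isogeny_bijective`);
* `stub_absIrrSqrtFive` — by `isAbsIrreducibleOverSqrt_five_of_mulVec_eq_self`, resp. the
  tree's `BCDT.isAbsIrreducibleOverSqrt_five_of_orderOf_eq_three`, with `det ρ̄ = χ̄₅`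
  (`det_eq_modPCyclotomicCharacter_of_isTorsionGaloisRep_holds`, the Weil pairing).

## References

* [RubinCSS1997] K. Rubin, *Modularity of mod 5 representations*, in: G. Cornell,
  J. H. Silverman, G. Stevens (eds.), *Modular Forms and Fermat's Last Theorem*, Springer (1997),
  Prop. 7 and its proof.
* [Serre1972] J.-P. Serre, Invent. Math. 15 (1972) 259–331, §1.11, Prop. 11 (Cor.) and
  Prop. 12 c).
* [SerreAbelianLadic1968] J.-P. Serre, *Abelian ℓ-adic representations and elliptic curves*
  (1968), Ch. IV, A.1.2–A.1.3.
* [Silverman1994] J. H. Silverman, *Advanced Topics in the Arithmetic of Elliptic Curves*,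
  IV.10.2.
-/

-- `Summit.<Summit>.<Problem>` is the mandated summit-side namespace (CONVENTIONS §2); for the
-- single-conjunct summit `ABC` the two coincide, so the duplicate `ABC.ABC` is deliberate.
set_option linter.dupNamespace false

noncomputable section

open scoped MatrixGroups NumberField

open Matrix Field IsDedekindDomain
open Literature.NumberTheory.EllipticCurves
open Literature.NumberTheory.Automorphic
open Literature.NumberTheory.Automorphic.BCDT
open Literature.NumberTheory.GaloisRepresentations
open WeierstrassCurve

namespace Summit.ABC.ABC.Theorems

/-! ## `25 ∤ N_E`: good or multiplicative reduction at `5` -/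

/-- **`25 ∤ N_E` means `E` is semistable at `5`**: for an elliptic curve `E/ℚ` with
`25 ∤ N_E` the conductor exponent at `5` is `≤ 1` (`N_E = ∏ p^{f_p}`,
`factorization_conductorNorm_holds`), so the reduction at the place `v` of `ℚ` over `5` is not
additive (`f_v ≥ 2` iff additive, `two_le_conductorExponent_iff_holds`), i.e. it is good or
multiplicative. [cite: Silverman1994, IV.10.2] -/
theorem hasGoodReductionAt_or_hasMultiplicativeReductionAt_of_not_dvd_conductorNorm
    (W : WeierstrassCurve ℚ) [W.IsElliptic] (h25 : ¬ 25 ∣ W.conductorNorm ℤ)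
    {v : HeightOneSpectrum (𝓞 ℚ)} (hv : (Rat.HeightOneSpectrum.primesEquiv v : ℕ) = 5) :
    W.HasGoodReductionAt v ∨ W.HasMultiplicativeReductionAt v := by
  classical
  set p5 : Nat.Primes := ⟨5, Nat.prime_five⟩ with hp5
  have hvp : Rat.HeightOneSpectrum.primesEquiv v = p5 := Subtype.ext hv
  set vZ : HeightOneSpectrum ℤ := (Rat.HeightOneSpectrum.primesEquiv (R := ℤ)).symm p5 with hvZ
  -- `f₅(E) ≤ 1` over `ℤ`
  have hfZ : W.conductorExponent vZ ≤ 1 := by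
    have hfac := factorization_conductorNorm_holds W vZ
    have hgen : Rat.HeightOneSpectrum.natGenerator vZ = 5 := by
      change ((Rat.HeightOneSpectrum.primesEquiv vZ : Nat.Primes) : ℕ) = 5
      rw [hvZ, Equiv.apply_symm_apply]
    rw [hgen] at hfac
    by_contra hlt
    apply h25
    have h2 : 2 ≤ (W.conductorNorm ℤ).factorization 5 := by rw [hfac]; omega
    have h3 := (Nat.Prime.pow_dvd_iff_le_factorization Nat.prime_five
      (conductorNorm_pos_holds W).ne').mpr h2
    norm_num at h3
    exact h3
  -- hence over `𝓞 ℚ`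
  have hf : W.conductorExponent v ≤ 1 := by
    rw [conductorExponent_ringOfIntegers_eq W v, hvp]; exact hfZ
  -- not additive
  have hnot : ¬ W.HasAdditiveReductionAt v := by
    intro hadd
    have h2 : 2 ≤ W.conductorExponent v := by
      rw [two_le_conductorExponent_iff_holds v W]; exact hadd
    omega
  rcases W.hasGoodReductionAt_or_hasMultiplicativeReductionAt_or_hasAdditiveReductionAt v with
    hg | hm | ha
  · exact Or.inl hg
  · exact Or.inr hm
  · exact absurd ha hnot

/-! ## The local datum at `5`: multiplicative, ordinary and supersingular reduction -/

/-- **Multiplicative (indeed potentially multiplicative) reduction at `5`.**  If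
`ord_5(j(E)) < 0` and `ρ̄` is a framed model of `E[5]`, there is `τ₀ ∈ Γ_ℚ` — an inertia element
at `5` with `χ̄₅(τ₀) = 2` (`ℚ(ζ₅)/ℚ` is totally ramified at `5`,
`exists_mem_inertia_modNCyclotomicCharacter_eq`) — with `χ̄₅(τ₀)² ≠ 1` such that `ρ̄(τ₀²)` fixes
a non-zero vector (`(τ₀² - 1) E[5]` has at most `5` elements: `stub_absIrrSqrtFive_local` of
`…StubAbsIrrSqrtFiveLocal`). [cite: SerreAbelianLadic1968, IV A.1.2–A.1.3] -/
theorem exists_sq_mulVec_eq_self_of_one_lt_valuation_j (W : WeierstrassCurve ℚ) [W.IsElliptic]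
    {v : HeightOneSpectrum (𝓞 ℚ)} (hv : (Rat.HeightOneSpectrum.primesEquiv v : ℕ) = 5)
    (hj : 1 < v.valuation ℚ W.j) {ρ : ModPGaloisRep ℚ (ZMod 5) 2}
    (hρ : W.IsTorsionGaloisRep 5 ρ) :
    ∃ τ₀ : absoluteGaloisGroup ℚ, modPCyclotomicCharacterZMod ℚ 5 τ₀ ^ 2 ≠ 1 ∧
      ∃ v₁ : Fin 2 → ZMod 5, v₁ ≠ 0 ∧
        ((ρ (τ₀ * τ₀) : GL (Fin 2) (ZMod 5)) : Matrix (Fin 2) (Fin 2) (ZMod 5)) *ᵥ v₁ = v₁ := by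
  have h5v : ((5 : ℕ) : 𝓞 ℚ) ∈ v.asIdeal := by
    rw [natCast_mem_asIdeal_iff_eq_primesEquiv_symm v Nat.prime_five, Equiv.eq_symm_apply]
    exact Subtype.ext hv
  obtain ⟨𝔓, h𝔓, hfixed⟩ := stub_absIrrSqrtFive_local W v h5v hj
  -- `τ₀ ∈ I_𝔓` with `χ̄₅(τ₀) = 2`
  set a : (ZMod 5)ˣ := ZMod.unitOfCoprime 2 (by norm_num) with ha
  obtain ⟨τ₀, hτ₀I, hτ₀χ⟩ := exists_mem_inertia_modNCyclotomicCharacter_eq (m := 5) (p := 5)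
    (k := 0) (d := 1) (by norm_num) (by norm_num) hv h𝔓 (a := a) (Subsingleton.elim _ _)
  refine ⟨τ₀, ?_, ?_⟩
  · rw [modPCyclotomicCharacterZMod_eq_modNCyclotomicCharacter, hτ₀χ, ha]
    decide
  · obtain ⟨P, hP0, hP⟩ := hfixed τ₀ hτ₀I
    obtain ⟨e, he⟩ := hρ
    refine ⟨e P, fun h0 ↦ hP0 (e.injective (h0.trans (map_zero e).symm)), ?_⟩
    rw [← he, hP]

/-- **Good ordinary reduction at `5`** (Serre 1972, §1.11, Prop. 11 and Cor.).  For `E/ℚ`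
globally minimal with `5 ∤ Δ_E`, `5 ∤ a₅(E)`, a framed model `ρ̄` of `E[5]` with `det ρ̄ = χ̄₅`:
there is an inertia element `τ₀` at `5` acting on `E[5]` as `(2 *; 0 1)` in a basis whose first
vector spans the kernel of reduction (`exists_line_of_not_dvd_frobeniusTrace_of_mem_primesAbove`,
`exists_mem_inertia_smul_eq_of_sub_mem_line`); so `χ̄₅(τ₀) = det ρ̄(τ₀) = 2`, `χ̄₅(τ₀)² ≠ 1`, and
`ρ̄(τ₀)` (hence `ρ̄(τ₀²)`) fixes a non-zero vector. [cite: Serre1972, §1.11 Prop. 11 and Cor.] -/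
theorem exists_sq_mulVec_eq_self_of_not_dvd_frobeniusTrace (W : WeierstrassCurve ℚ)
    [W.IsGloballyMinimal] [W.IsElliptic] (hΔ : ¬ ((5 : ℕ) : ℤ) ∣ minimalDiscriminantInt W)
    (hord : ¬ ((5 : ℕ) : ℤ) ∣ W.frobeniusTrace 5) {ρ : ModPGaloisRep ℚ (ZMod 5) 2}
    (hρ : W.IsTorsionGaloisRep 5 ρ)
    (hdet : ∀ σ : absoluteGaloisGroup ℚ,
      Matrix.GeneralLinearGroup.det (ρ σ) = modPCyclotomicCharacterZMod ℚ 5 σ) :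
    ∃ τ₀ : absoluteGaloisGroup ℚ, modPCyclotomicCharacterZMod ℚ 5 τ₀ ^ 2 ≠ 1 ∧
      ∃ v₁ : Fin 2 → ZMod 5, v₁ ≠ 0 ∧
        ((ρ (τ₀ * τ₀) : GL (Fin 2) (ZMod 5)) : Matrix (Fin 2) (Fin 2) (ZMod 5)) *ᵥ v₁ = v₁ := by
  classical
  letI : Module (ZMod 5) (geomTorsion W ((5 : ℕ) : ℤ)) := AddSubgroup.torsionBy.zmodModule
  set v : HeightOneSpectrum (𝓞 ℚ) :=
    (Rat.HeightOneSpectrum.primesEquiv (R := 𝓞 ℚ)).symm ⟨5, Nat.prime_five⟩ with hv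
  have hv5 : (Rat.HeightOneSpectrum.primesEquiv v : ℕ) = 5 := by rw [hv, Equiv.apply_symm_apply]
  obtain ⟨𝔓, -, h𝔓⟩ := exists_ideal_placeOver 5 hv5
  obtain ⟨v₀, hv₀, hquot⟩ :=
    exists_line_of_not_dvd_frobeniusTrace_of_mem_primesAbove 5 hΔ hord hv5 h𝔓
  set a : (ZMod 5)ˣ := ZMod.unitOfCoprime 2 (by norm_num) with ha
  obtain ⟨τ, hτI, hτv₀⟩ := W.exists_mem_inertia_smul_eq_of_sub_mem_line 5 hv5 h𝔓 hv₀ hquot a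
  obtain ⟨e, he⟩ := hρ
  set t : Matrix (Fin 2) (Fin 2) (ZMod 5) :=
    ((ρ τ : GL (Fin 2) (ZMod 5)) : Matrix (Fin 2) (Fin 2) (ZMod 5)) with ht
  have hev₀ : e v₀ ≠ 0 := fun h0 ↦ hv₀ (e.injective (h0.trans (map_zero e).symm))
  have htv₀ : t *ᵥ e v₀ = (2 : ZMod 5) • e v₀ := by
    rw [ht, ← he, hτv₀, ZMod.map_smul e, ha, ZMod.coe_unitOfCoprime, Nat.cast_ofNat]
  have htq : ∀ y : Fin 2 → ZMod 5, ∃ b : ZMod 5, t *ᵥ y - y = b • e v₀ := by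
    intro y
    obtain ⟨b, hb⟩ := hquot τ hτI (e.symm y)
    refine ⟨b, ?_⟩
    have h1 := congrArg e hb
    rw [map_sub, ZMod.map_smul e b v₀, AddEquiv.apply_symm_apply] at h1
    rw [← h1, he, AddEquiv.apply_symm_apply, ht]
  -- `det ρ̄(τ) = 2`
  have hdett : t.det = 2 := det_eq_of_sub_mem_line hev₀ htv₀ htq
  refine ⟨τ, ?_, ?_⟩
  · intro h1
    have h2 := congrArg (fun u : (ZMod 5)ˣ ↦ (u : ZMod 5)) (hdet τ)
    simp only [Matrix.GeneralLinearGroup.val_det_apply] at h2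
    have h3 : ((modPCyclotomicCharacterZMod ℚ 5 τ : (ZMod 5)ˣ) : ZMod 5) ^ 2 = 1 := by
      rw [← Units.val_pow_eq_pow_val, h1, Units.val_one]
    rw [← h2] at h3
    have h4 : t.det ^ 2 = 1 := h3
    rw [hdett] at h4
    exact absurd h4 (by decide)
  · -- a vector `y ∉ 𝔽₅ (e v₀)`; then `y - b • e v₀` is fixed by `t`
    obtain ⟨y, hy⟩ : ∃ y : Fin 2 → ZMod 5, y ∉ (ZMod 5) ∙ e v₀ := by
      by_contra hall
      push Not at hall
      have htop : (ZMod 5) ∙ e v₀ = ⊤ := Submodule.eq_top_iff'.mpr hall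
      have h1 := finrank_span_singleton (K := ZMod 5) hev₀
      rw [htop, finrank_top] at h1
      simp at h1
    obtain ⟨b, hb⟩ := htq y
    refine ⟨y - b • e v₀, fun h0 ↦ hy ?_, ?_⟩
    · rw [sub_eq_zero] at h0
      exact Submodule.mem_span_singleton.mpr ⟨b, h0.symm⟩
    · have hty : t *ᵥ y = b • e v₀ + y := eq_add_of_sub_eq hb
      have htfix : t *ᵥ (y - b • e v₀) = y - b • e v₀ := by
        rw [mulVec_sub, mulVec_smul, htv₀, hty, smul_smul]
        module
      rw [map_mul, Units.val_mul, ← mulVec_mulVec]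
      change t *ᵥ (t *ᵥ (y - b • e v₀)) = y - b • e v₀
      rw [htfix, htfix]

/-- **Good supersingular reduction at `5`** (Serre 1972, §1.11, Prop. 12 c)).  For `E/ℚ`
globally minimal with `5 ∤ Δ_E`, `5 ∣ a₅(E)` and a framed model `ρ̄` of `E[5]`, the image of
`ρ̄` contains an element of order `3`: the image of an inertia group at `5` in `Aut(E[5])` is
cyclic of order `24 = 5² - 1` (`isCyclic_and_card_inertia_map_of_dvd_frobeniusTrace`, from the
surjectivity of the tame Kummer character `exists_mem_inertia_smul_eq_mul_of_pow_eq`), and the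
eighth power of a generator has order `3`. [cite: Serre1972, §1.11 Prop. 12 c)] -/
theorem exists_orderOf_eq_three_of_dvd_frobeniusTrace (W : WeierstrassCurve ℚ)
    [W.IsGloballyMinimal] [W.IsElliptic] (hΔ : ¬ ((5 : ℕ) : ℤ) ∣ minimalDiscriminantInt W)
    (hss : ((5 : ℕ) : ℤ) ∣ W.frobeniusTrace 5) {ρ : ModPGaloisRep ℚ (ZMod 5) 2}
    (hρ : W.IsTorsionGaloisRep 5 ρ) : ∃ σ : absoluteGaloisGroup ℚ, orderOf (ρ σ) = 3 := by
  classical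
  set v : HeightOneSpectrum (𝓞 ℚ) :=
    (Rat.HeightOneSpectrum.primesEquiv (R := 𝓞 ℚ)).symm ⟨5, Nat.prime_five⟩ with hv
  have hv5 : (Rat.HeightOneSpectrum.primesEquiv v : ℕ) = 5 := by rw [hv, Equiv.apply_symm_apply]
  obtain ⟨𝔓, hmem, h𝔓⟩ := exists_ideal_placeOver 5 hv5
  have hT : ∀ π ζ : AlgebraicClosure ℚ, π ^ (5 ^ 2 - 1) = ((5 : ℕ) : AlgebraicClosure ℚ) →
      ζ ^ (5 ^ 2 - 1) = 1 → ∃ s ∈ 𝔓.inertia (absoluteGaloisGroup ℚ), s • π = ζ * π :=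
    fun π ζ hπ hζ ↦ exists_mem_inertia_smul_eq_mul_of_pow_eq 5 (by norm_num) hv5 h𝔓 hπ hζ
  obtain ⟨hcyc, hcard⟩ :=
    isCyclic_and_card_inertia_map_of_dvd_frobeniusTrace 5 hΔ hss (by norm_num) hmem hT
  haveI := hcyc
  obtain ⟨z, hz⟩ := IsCyclic.exists_ofOrder_eq_natCard
    (α := (𝔓.inertia (absoluteGaloisGroup ℚ)).map (galoisRepTorsion W ((5 : ℕ) : ℤ)))
  rw [hcard] at hz
  obtain ⟨σ, -, hσ⟩ := Subgroup.mem_map.mp z.2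
  have hordσ : orderOf (galoisRepTorsion W ((5 : ℕ) : ℤ) σ) = 24 := by
    rw [hσ, Subgroup.orderOf_coe, hz]; norm_num
  have hord8 : orderOf (galoisRepTorsion W ((5 : ℕ) : ℤ) (σ ^ 8)) = 3 := by
    rw [map_pow, orderOf_pow_of_dvd (by norm_num) (by rw [hordσ]; norm_num), hordσ]
  refine ⟨σ ^ 8, ?_⟩
  rw [← hord8]
  refine orderOf_eq_orderOf_iff.mpr fun n ↦ ?_
  rw [← map_pow, ← map_pow, galoisRepTorsion_eq_one_iff']
  -- both sides say: `(σ⁸)ⁿ` fixes `E[5]` pointwise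
  refine ⟨fun h1 P ↦ ?_, eq_one_of_forall_smul_eq hρ⟩
  obtain ⟨e, he⟩ := hρ
  have h2 := he ((σ ^ 8) ^ n) P
  rw [h1, Units.val_one, one_mulVec] at h2
  exact e.injective h2

/-- **The local datum at `5`** (the arithmetic half of Rubin, CSS 1997, Prop. 7).  For an
elliptic curve `E/ℚ` with `25 ∤ N_E` and a framed model `ρ̄` of `E[5]` (`det ρ̄ = χ̄₅`), either
some `τ₀ ∈ Γ_ℚ` has `χ̄₅(τ₀)² ≠ 1` while `ρ̄(τ₀²)` fixes a non-zero vector (multiplicative or good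
ordinary reduction at `5`), or the image of `ρ̄` contains an element of order `3` (good
supersingular reduction).  The good case is read on a global minimal model `C • E`
(`hasGlobalMinimalModel_rat_holds`), which has the same `5`-torsion Galois module
(`isTorsionGaloisRep_of_isogeny_bijective`). [cite: RubinCSS1997, Prop. 7] -/
theorem exists_sq_mulVec_eq_self_or_orderOf_eq_three (W : WeierstrassCurve ℚ) [W.IsElliptic]
    (h25 : ¬ 25 ∣ W.conductorNorm ℤ) {ρ : ModPGaloisRep ℚ (ZMod 5) 2}
    (hρ : W.IsTorsionGaloisRep 5 ρ)
    (hdet : ∀ σ : absoluteGaloisGroup ℚ,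
      Matrix.GeneralLinearGroup.det (ρ σ) = modPCyclotomicCharacterZMod ℚ 5 σ) :
    (∃ τ₀ : absoluteGaloisGroup ℚ, modPCyclotomicCharacterZMod ℚ 5 τ₀ ^ 2 ≠ 1 ∧
      ∃ v₁ : Fin 2 → ZMod 5, v₁ ≠ 0 ∧
        ((ρ (τ₀ * τ₀) : GL (Fin 2) (ZMod 5)) : Matrix (Fin 2) (Fin 2) (ZMod 5)) *ᵥ v₁ = v₁) ∨
    ∃ σ : absoluteGaloisGroup ℚ, orderOf (ρ σ) = 3 := by
  classical
  set v : HeightOneSpectrum (𝓞 ℚ) :=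
    (Rat.HeightOneSpectrum.primesEquiv (R := 𝓞 ℚ)).symm ⟨5, Nat.prime_five⟩ with hv
  have hv5 : (Rat.HeightOneSpectrum.primesEquiv v : ℕ) = 5 := by rw [hv, Equiv.apply_symm_apply]
  rcases hasGoodReductionAt_or_hasMultiplicativeReductionAt_of_not_dvd_conductorNorm W h25 hv5
    with hg | hm
  · -- good reduction: pass to a global minimal model `C • W`
    obtain ⟨C, hC⟩ := hasGlobalMinimalModel_rat_holds W
    haveI := hC
    have hgood : (C • W).HasGoodReductionAtPrime 5 := by
      rw [hasGoodReductionAtPrime_primesEquiv_iff_holds (C • W) v 5 hv5,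
        hasGoodReductionAt_smul_iff_holds v W C]
      exact hg
    have hΔ := (C • W).not_dvd_minimalDiscriminantInt_of_hasGoodReductionAtPrime' 5 hgood
    have hρ' : (C • W).IsTorsionGaloisRep 5 ρ :=
      isTorsionGaloisRep_of_isogeny_bijective (VariableChange.toIsogeny W C)
        ⟨VariableChange.toIsogeny_injective W C, VariableChange.toIsogeny_surjective W C⟩ hρ
    by_cases hss : ((5 : ℕ) : ℤ) ∣ (C • W).frobeniusTrace 5
    · exact Or.inr (exists_orderOf_eq_three_of_dvd_frobeniusTrace (C • W) hΔ hss hρ')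
    · exact Or.inl (exists_sq_mulVec_eq_self_of_not_dvd_frobeniusTrace (C • W) hΔ hss hρ' hdet)
  · -- multiplicative reduction: `ord_5(j) < 0`
    exact Or.inl (exists_sq_mulVec_eq_self_of_one_lt_valuation_j W hv5
      (one_lt_valuation_j_of_hasMultiplicativeReductionAt' v W hm) hρ)

/-! ## The stub -/

/-- **Stub S4b — Rubin's Prop. 7: semistable at `5` and irreducible ⇒ absolutely irreducible
over `ℚ(√5)`.**  For an elliptic curve `E/ℚ` with `25 ∤ N_E` (good or multiplicative reduction
at `5`) and `ρ̄_{E,5}` irreducible, `ρ̄_{E,5}|_{ℚ(√5)}` is absolutely irreducible: an inertia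
element `σ` at `5` with `det ρ̄(σ) = χ̄₅(σ)` of order `4` lies outside `Γ_{ℚ(√5)}`, and
`ρ̄(σ) ∼ (χ̄₅(σ) *; 0 1)` (ordinary or Tate curve) does not square to a scalar, as it would have
to if `ρ̄` were induced from `Γ_{ℚ(√5)}`.  Proof: the local datum
`exists_sq_mulVec_eq_self_or_orderOf_eq_three` (determinant by the Weil pairing,
`det_eq_modPCyclotomicCharacter_of_isTorsionGaloisRep_holds`) fed to the group-theoretic
criterion `isAbsIrreducibleOverSqrt_five_of_mulVec_eq_self`, resp. (supersingular case) to the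
tree's `BCDT.isAbsIrreducibleOverSqrt_five_of_orderOf_eq_three`. [cite: RubinCSS1997, Prop. 7] -/
theorem stub_absIrrSqrtFive :
    ∀ (W : WeierstrassCurve ℚ) [W.IsElliptic], ¬ 25 ∣ W.conductorNorm ℤ →
      ∀ ρ : ModPGaloisRep ℚ (ZMod 5) 2, W.IsTorsionGaloisRep 5 ρ →
        FramedRep.IsIrreducible ρ → ρ.IsAbsIrreducibleOverSqrt 5 := by
  intro W _ h25 ρ hρ hirr
  have hdet := W.det_eq_modPCyclotomicCharacter_of_isTorsionGaloisRep_holds 5 ρ hρ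
  rcases exists_sq_mulVec_eq_self_or_orderOf_eq_three W h25 hρ hdet with
    ⟨τ₀, hτ₀, v₁, hv₁, hfix⟩ | ⟨σ, hσ⟩
  · exact isAbsIrreducibleOverSqrt_five_of_mulVec_eq_self ρ hdet hirr hτ₀ hv₁ hfix
  · exact isAbsIrreducibleOverSqrt_five_of_orderOf_eq_three ρ hdet hσ

end Summit.ABC.ABC.Theorems

end
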